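import Summits.QuantumFields.BalabanUV.Beta.CompositeCorrectorLocalityGeneric

/-!
# `BalabanUV.Beta.CompositeCorrectorLinearGeneric` — binder row D1 ∕ (C1): **THE SCHEME-GENERIC COMPOSITE, ITS DEFECT POTENTIAL AND ITS CORRECTOR PAIR ARE ℝ-LINEAR IN THE
# FIELD** — leaf-06 g32's `CompositeCorrectorLinear` §2–§3 (`compLinAvgAt_add ∕ _smul`, `compDefectAt_add ∕ _zero' ∕ _smul`, `corrPsi_add ∕ _smul ∕ _zero ∕ _sum_smul`,
# `corrPhi_…`) re-proved for ANY one-step averaging family from four one-step letters (subtractivity ×2, homogeneity ×2) (§1), and INSTANTIATED at the (0.4)-SYMMETRISED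
# scheme (§2–§3): one-level letters `symLinAvgAt_smul' ∕ avSym_smul ∕ lamSym_smul`, then **`compLinAvgSymAt_add ∕ _smul`**, **`compDefectSymAt_add ∕ _zero' ∕ _smul`**,
# **`corrPsiSym_add ∕ _smul ∕ _zero ∕ _sum_smul`**, **`corrPhiSym_add ∕ _smul ∕ _zero ∕ _sum_smul`** — K-U3d-sym's FIFTH form-level brick: with PART 127 (finite read set) the
# two inputs of leaf-06's APPLY BRIDGE «no hypothesis on K» for the (0.4) pair `Ψˢ_m ∕ Φˢ_m` (row OWNER an2 gen 89; sequel of PART 124–127)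

HONEST FRAMING (cell charter, verbatim): «discharging BetaPertH makes Balaban's UV stability UNCONDITIONAL — a real
constructive-QFT result; it is NOT the continuum limit and NOT the Clay problem.»
HONEST DEPENDENCY: continuum YM on T⁴ ⇐ BetaPertH ∧ nine spine estimates (0/9 proved); BetaPertH ⇐ (D1) ∧ (D4) ∧ CAP+tail;
G-an2-4 gates asym, D1 and NE2/3/4.
ABSOLUTE RULE (cell, verbatim): «No internally-minted statement may enter as a cited fact. Every hypothesis is either kernel-proved in this
package or a verbatim quotation of a PUBLISHED theorem with page reference. The manuscript(s) under audit are NOT citable for their own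
disputed steps — they are the thing under adjudication; programme-internal (2001/route/tribunal) claims are never citable.»
NOTHING below is cited: no `[cite: …]`, no `Prop` fact, no `def`.  [folklore] module algebra over the cell's OWN typed objects BY NAME: PART 124's `compAvOf ∕ compDefectOf ∕ avSym ∕
lamSym ∕ compLinAvgSymAt ∕ compDefectSymAt` (`_succ ∕ _zero` clauses), PART 126's `compAvOf_sub ∕ compDefectOf_sub ∕ avSym_sub ∕ lamSym_sub ∕ corrPhiOf ∕ corrPsiOf ∕ corrPhiSym ∕
corrPsiSym`, PART 127's pointwise forms `corrPsiOf_apply ∕ corrPhiOf_apply`, leaf-06's `CompositeCorrectorLinear.blockSum_smul`, an1's `AffineReproduction.contourSum_sub`,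
`CompositeCorrectorForms.contourSum_smul'`, an2's `SymmetrisedAxialPotential.symLinAvgAt_eq_contourSum_sub_dz` and `SymCorrectorForms.SymLamAt_smul ∕ zetaS_smul`.  It asserts
nothing about Bałaban's non-linear averages beyond their typed linearisations; it values nothing; option L of REFEREE-TABLE-89 is NOT commissioned and its KERNEL level is untouched.

WHY.  K-U3d's kernelisation `kerOf` turns a form-level corrector into a kernel acting on kernel columns; that `comp (kerOf Ψ) K` equals `Ψ` applied to the columns of `K`
(leaf-06's APPLY BRIDGE `CompositeCorrectorKernel.apply_eq_sum_of_depOn`, «no hypothesis on K») needs exactly two form-level inputs: `A ↦ (Ψ A)_α(x)` is ℝ-LINEAR (this file,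
for the generic and the (0.4) pair) and READS FINITELY MANY BONDS (PART 127).  After this file every form-level letter that K-U3d's kernel files (`CompositeCorrectorKernel`,
`…KernelSpr`, `…Slot`) consume about `corrPsi ∕ corrPhi` exists BY NAME for `corrPsiSym ∕ corrPhiSym`; what remains of K-U3d-sym is kernel-level re-instantiation only.

WHAT (`d` the lattice dimension; `L` the block side; levels `k`, `m`; scalar `c`; all [folklore]):
§1 GENERIC (`Av`, `lam`, `L`) from the one-step letters (S) `Av k (A − B) = Av k A − Av k B`, (S′) `lam k (A − B) = lam k A − lam k B`, (H) `Av k (c • A) = c • Av k A`,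
   (H′) `lam k (c • A) = c • lam k A`: `compAvOf_add` (S), `compAvOf_smul` (H), `compDefectOf_add ∕ compDefectOf_zero'` (S)(S′), `compDefectOf_smul` (H)(H′);
   `corrPsiOf_add ∕ _smul ∕ _zero ∕ _sum_smul`, `corrPhiOf_add ∕ _smul ∕ _zero ∕ _sum_smul`.
§2 THE (0.4) ONE-STEP LETTERS (roots `ρs : ℕ → Site d`, any): `symLinAvgAt_smul'` (the symmetrised rooted linear average is ℝ-homogeneous), `avSym_smul` (H), `lamSym_smul` (H′)
   (subtractivity (S)(S′) = PART 126's `avSym_sub ∕ lamSym_sub`).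
§3 THE (0.4) COMPOSITE: `compLinAvgSymAt_add ∕ _smul`, `compDefectSymAt_add ∕ _zero' ∕ _smul` (any roots `ρs`); `corrPsiSym_add ∕ _smul ∕ _zero ∕ _sum_smul`,
   `corrPhiSym_add ∕ _smul ∕ _zero ∕ _sum_smul` (roots `r : ℕ → (Fin d → ℕ)`, no in-block hypothesis needed for linearity) — literally leaf-06's §2–§3 statements with
   `compLinAvgAt ∕ compDefectAt ∕ corrPsi ∕ corrPhi ↦ compLinAvgSymAt ∕ compDefectSymAt ∕ corrPsiSym ∕ corrPhiSym`.
Namespace: PART 124's `…CompositeAveragingCoarseExactGeneric` is REOPENED on purpose (all names new; `symLinAvgAt_smul'` primed to stay clear of any future unprimed letter in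
`SymmetrisedAxialPotential`).  Provenance: β sub-cell, unit `b2b-balaban-beta-an2` gen 89 (row-D1 OWNER), 2026-08-30; charter-neutral library typing (no L-root, no (I)-class
object).  NOT (C1), NOT (T-ID), NOT D1, NEVER «G-an2-4 closed», NOT `BetaPertH`, NOT continuum, NOT Clay.
-/

namespace Summit.QuantumFields.BalabanUV.Beta.CompositeAveragingCoarseExactGeneric

open Finset
open scoped BigOperators Nat
open Literature.MathematicalPhysics.QuantumFieldTheory.Balaban1983to89.Beta
open AffineAveraging (Site Form0 Form1 box toSite unitVec dz blockSum contourSum)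
open AffineReproduction (contourSum_sub)
open Summit.QuantumFields.BalabanUV.Beta.SymmetrisedAxialPotential (SymLamAt symLinAvgAt symLinAvgAt_eq_contourSum_sub_dz)
open Summit.QuantumFields.BalabanUV.Beta.SymCorrectorForms (zetaS SymLamAt_smul zetaS_smul)
open Summit.QuantumFields.BalabanUV.Beta.CompositeCorrectorForms (ext ext_apply contourSum_smul')
open Summit.QuantumFields.BalabanUV.Beta.CompositeCorrectorLinear (blockSum_smul)

noncomputable section

variable {d : ℕ}

/-! ## §1 Generic: additivity and homogeneity of the composite, the defect potential and the correctors -/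

section Generic

variable {Av : ℕ → Form1 d ℝ → Form1 d ℝ} {lam : ℕ → Form1 d ℝ → Form0 d ℝ} {L : ℕ}

/-- [folklore] **THE GENERIC COMPOSITE IS ADDITIVE** (from subtractivity (S), PART 126's `compAvOf_sub`). -/
theorem compAvOf_add (hS : ∀ (k : ℕ) (A B : Form1 d ℝ), Av k (A - B) = Av k A - Av k B) (m : ℕ) (A B : Form1 d ℝ) :
    compAvOf Av m (A + B) = compAvOf Av m A + compAvOf Av m B := by
  have h := compAvOf_sub Av hS (A + B) B m
  rw [add_sub_cancel_right] at h
  rw [h, sub_add_cancel]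

/-- [folklore] **THE GENERIC COMPOSITE IS ℝ-HOMOGENEOUS** (from the one-step letter (H)). -/
theorem compAvOf_smul (hH : ∀ (k : ℕ) (c : ℝ) (A : Form1 d ℝ), Av k (c • A) = c • Av k A) (c : ℝ) (A : Form1 d ℝ) :
    ∀ m, compAvOf Av m (c • A) = c • compAvOf Av m A
  | 0 => rfl
  | m + 1 => by rw [compAvOf_succ, compAvOf_succ, compAvOf_smul hH c A m, hH]

/-- [folklore] **THE GENERIC DEFECT POTENTIAL IS ADDITIVE** (from (S)(S′), PART 126's `compDefectOf_sub`). -/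
theorem compDefectOf_add (hS : ∀ (k : ℕ) (A B : Form1 d ℝ), Av k (A - B) = Av k A - Av k B)
    (hS' : ∀ (k : ℕ) (A B : Form1 d ℝ), lam k (A - B) = lam k A - lam k B) (m : ℕ) (A B : Form1 d ℝ) :
    compDefectOf Av lam L m (A + B) = compDefectOf Av lam L m A + compDefectOf Av lam L m B := by
  have h := compDefectOf_sub Av lam L hS hS' (A + B) B m
  rw [add_sub_cancel_right] at h
  rw [h, sub_add_cancel]

/-- [folklore] The generic defect potential of the zero field vanishes (from (S)(S′)). -/
theorem compDefectOf_zero' (hS : ∀ (k : ℕ) (A B : Form1 d ℝ), Av k (A - B) = Av k A - Av k B)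
    (hS' : ∀ (k : ℕ) (A B : Form1 d ℝ), lam k (A - B) = lam k A - lam k B) (m : ℕ) :
    compDefectOf Av lam L m (0 : Form1 d ℝ) = 0 := by
  have h := compDefectOf_sub Av lam L hS hS' (0 : Form1 d ℝ) 0 m
  rwa [sub_self, sub_self] at h

/-- [folklore] **THE GENERIC DEFECT POTENTIAL IS ℝ-HOMOGENEOUS** (from (H)(H′) and leaf-06's `blockSum_smul`). -/
theorem compDefectOf_smul (hH : ∀ (k : ℕ) (c : ℝ) (A : Form1 d ℝ), Av k (c • A) = c • Av k A)
    (hH' : ∀ (k : ℕ) (c : ℝ) (A : Form1 d ℝ), lam k (c • A) = c • lam k A) (c : ℝ) (A : Form1 d ℝ) :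
    ∀ m, compDefectOf Av lam L m (c • A) = c • compDefectOf Av lam L m A
  | 0 => by rw [compDefectOf_zero, compDefectOf_zero, smul_zero]
  | m + 1 => by
      rw [compDefectOf_succ, compDefectOf_succ, compDefectOf_smul hH hH' c A m, compAvOf_smul hH, hH', blockSum_smul, ← smul_add]

/-- [folklore] `Ψ_m` is additive (letters (S)(S′)). -/
theorem corrPsiOf_add (hS : ∀ (k : ℕ) (A B : Form1 d ℝ), Av k (A - B) = Av k A - Av k B)
    (hS' : ∀ (k : ℕ) (A B : Form1 d ℝ), lam k (A - B) = lam k A - lam k B) (m : ℕ) (A B : Form1 d ℝ) :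
    corrPsiOf Av lam L m (A + B) = corrPsiOf Av lam L m A + corrPsiOf Av lam L m B := by
  funext α x
  simp only [corrPsiOf_apply, Pi.add_apply, compDefectOf_add hS hS']
  ring

/-- [folklore] `Ψ_m` is ℝ-homogeneous (letters (H)(H′)). -/
theorem corrPsiOf_smul (hH : ∀ (k : ℕ) (c : ℝ) (A : Form1 d ℝ), Av k (c • A) = c • Av k A)
    (hH' : ∀ (k : ℕ) (c : ℝ) (A : Form1 d ℝ), lam k (c • A) = c • lam k A) (m : ℕ) (c : ℝ) (A : Form1 d ℝ) :
    corrPsiOf Av lam L m (c • A) = c • corrPsiOf Av lam L m A := by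
  funext α x
  simp only [corrPsiOf_apply, Pi.smul_apply, smul_eq_mul, compDefectOf_smul hH hH']
  ring

/-- [folklore] `Ψ_m 0 = 0` (letters (S)(S′)). -/
theorem corrPsiOf_zero (hS : ∀ (k : ℕ) (A B : Form1 d ℝ), Av k (A - B) = Av k A - Av k B)
    (hS' : ∀ (k : ℕ) (A B : Form1 d ℝ), lam k (A - B) = lam k A - lam k B) (m : ℕ) :
    corrPsiOf Av lam L m (0 : Form1 d ℝ) = 0 := by
  funext α x
  simp only [corrPsiOf_apply, Pi.zero_apply, compDefectOf_zero' hS hS', sub_self, mul_zero, add_zero]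

/-- [folklore] `Ψ_m` on a finite linear combination (all four letters). -/
theorem corrPsiOf_sum_smul {ι : Type*} (hS : ∀ (k : ℕ) (A B : Form1 d ℝ), Av k (A - B) = Av k A - Av k B)
    (hS' : ∀ (k : ℕ) (A B : Form1 d ℝ), lam k (A - B) = lam k A - lam k B)
    (hH : ∀ (k : ℕ) (c : ℝ) (A : Form1 d ℝ), Av k (c • A) = c • Av k A)
    (hH' : ∀ (k : ℕ) (c : ℝ) (A : Form1 d ℝ), lam k (c • A) = c • lam k A) (m : ℕ) (s : Finset ι) (c : ι → ℝ) (B : ι → Form1 d ℝ) :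
    corrPsiOf Av lam L m (∑ i ∈ s, c i • B i) = ∑ i ∈ s, c i • corrPsiOf Av lam L m (B i) := by
  classical
  induction s using Finset.induction_on with
  | empty => rw [Finset.sum_empty, Finset.sum_empty, corrPsiOf_zero hS hS']
  | insert i s hi ih => rw [Finset.sum_insert hi, Finset.sum_insert hi, corrPsiOf_add hS hS', corrPsiOf_smul hH hH', ih]

/-- [folklore] `Φ_m` is additive (letters (S)(S′)). -/
theorem corrPhiOf_add (hS : ∀ (k : ℕ) (A B : Form1 d ℝ), Av k (A - B) = Av k A - Av k B)
    (hS' : ∀ (k : ℕ) (A B : Form1 d ℝ), lam k (A - B) = lam k A - lam k B) (m : ℕ) (A B : Form1 d ℝ) :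
    corrPhiOf Av lam L m (A + B) = corrPhiOf Av lam L m A + corrPhiOf Av lam L m B := by
  funext α x
  simp only [corrPhiOf_apply, Pi.add_apply, compDefectOf_add hS hS']
  ring

/-- [folklore] `Φ_m` is ℝ-homogeneous (letters (H)(H′)). -/
theorem corrPhiOf_smul (hH : ∀ (k : ℕ) (c : ℝ) (A : Form1 d ℝ), Av k (c • A) = c • Av k A)
    (hH' : ∀ (k : ℕ) (c : ℝ) (A : Form1 d ℝ), lam k (c • A) = c • lam k A) (m : ℕ) (c : ℝ) (A : Form1 d ℝ) :
    corrPhiOf Av lam L m (c • A) = c • corrPhiOf Av lam L m A := by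
  funext α x
  simp only [corrPhiOf_apply, Pi.smul_apply, smul_eq_mul, compDefectOf_smul hH hH']
  ring

/-- [folklore] `Φ_m 0 = 0` (letters (S)(S′)). -/
theorem corrPhiOf_zero (hS : ∀ (k : ℕ) (A B : Form1 d ℝ), Av k (A - B) = Av k A - Av k B)
    (hS' : ∀ (k : ℕ) (A B : Form1 d ℝ), lam k (A - B) = lam k A - lam k B) (m : ℕ) :
    corrPhiOf Av lam L m (0 : Form1 d ℝ) = 0 := by
  funext α x
  simp only [corrPhiOf_apply, Pi.zero_apply, compDefectOf_zero' hS hS', sub_self, mul_zero]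

/-- [folklore] `Φ_m` on a finite linear combination (all four letters). -/
theorem corrPhiOf_sum_smul {ι : Type*} (hS : ∀ (k : ℕ) (A B : Form1 d ℝ), Av k (A - B) = Av k A - Av k B)
    (hS' : ∀ (k : ℕ) (A B : Form1 d ℝ), lam k (A - B) = lam k A - lam k B)
    (hH : ∀ (k : ℕ) (c : ℝ) (A : Form1 d ℝ), Av k (c • A) = c • Av k A)
    (hH' : ∀ (k : ℕ) (c : ℝ) (A : Form1 d ℝ), lam k (c • A) = c • lam k A) (m : ℕ) (s : Finset ι) (c : ι → ℝ) (B : ι → Form1 d ℝ) :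
    corrPhiOf Av lam L m (∑ i ∈ s, c i • B i) = ∑ i ∈ s, c i • corrPhiOf Av lam L m (B i) := by
  classical
  induction s using Finset.induction_on with
  | empty => rw [Finset.sum_empty, Finset.sum_empty, corrPhiOf_zero hS hS']
  | insert i s hi ih => rw [Finset.sum_insert hi, Finset.sum_insert hi, corrPhiOf_add hS hS', corrPhiOf_smul hH hH', ih]

end Generic

/-! ## §2 The (0.4) one-step letters: homogeneity of `symLinAvgAt`, `avSym`, `lamSym` -/

/-- [folklore] **THE SYMMETRISED ROOTED LINEAR AVERAGE IS ℝ-HOMOGENEOUS** (by the coarse-exact decomposition `symLinAvgAt = d!·contourSum − dz ∘ SymLamAt` and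
`SymLamAt_smul`). -/
theorem symLinAvgAt_smul' (ρ : Site d) (c : ℝ) (A : Form1 d ℝ) (N : ℕ) (μ : Fin d) (y : Site d) :
    symLinAvgAt ρ (c • A) N μ y = c * symLinAvgAt ρ A N μ y := by
  simp only [symLinAvgAt_eq_contourSum_sub_dz, contourSum_smul', SymLamAt_smul, dz, Pi.smul_apply, smul_eq_mul]
  ring

/-- [folklore] THE LETTER (H) AT THE SYM DATA: `avSym ρs L k (c • A) = c • avSym ρs L k A`. -/
theorem avSym_smul (ρs : ℕ → Site d) (L : ℕ) (k : ℕ) (c : ℝ) (A : Form1 d ℝ) : avSym ρs L k (c • A) = c • avSym ρs L k A := by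
  funext μ y
  simp only [avSym_apply, Pi.smul_apply, smul_eq_mul, symLinAvgAt_smul']
  ring

/-- [folklore] THE LETTER (H′) AT THE SYM DATA: `lamSym ρs L k (c • A) = c • lamSym ρs L k A` (an2's `zetaS_smul`). -/
theorem lamSym_smul (ρs : ℕ → Site d) (L : ℕ) (k : ℕ) (c : ℝ) (A : Form1 d ℝ) : lamSym ρs L k (c • A) = c • lamSym ρs L k A := by
  rw [lamSym_apply, lamSym_apply, zetaS_smul]

/-! ## §3 The (0.4) composite: `compLinAvgSymAt`, `compDefectSymAt`, `corrPsiSym`, `corrPhiSym` are ℝ-linear -/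

section Sym

variable (ρs : ℕ → Site d) (L : ℕ)

/-- [folklore] **THE (0.4) COMPOSITE IS ADDITIVE.** -/
theorem compLinAvgSymAt_add (m : ℕ) (A B : Form1 d ℝ) :
    compLinAvgSymAt ρs L m (A + B) = compLinAvgSymAt ρs L m A + compLinAvgSymAt ρs L m B :=
  compAvOf_add (avSym_sub ρs L) m A B

/-- [folklore] **THE (0.4) COMPOSITE IS ℝ-HOMOGENEOUS.** -/
theorem compLinAvgSymAt_smul (m : ℕ) (c : ℝ) (A : Form1 d ℝ) :
    compLinAvgSymAt ρs L m (c • A) = c • compLinAvgSymAt ρs L m A :=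
  compAvOf_smul (avSym_smul ρs L) c A m

/-- [folklore] **THE (0.4) DEFECT POTENTIAL IS ADDITIVE.** -/
theorem compDefectSymAt_add (m : ℕ) (A B : Form1 d ℝ) :
    compDefectSymAt ρs L m (A + B) = compDefectSymAt ρs L m A + compDefectSymAt ρs L m B :=
  compDefectOf_add (avSym_sub ρs L) (lamSym_sub ρs L) m A B

/-- [folklore] The (0.4) defect potential of the zero field vanishes. -/
theorem compDefectSymAt_zero' (m : ℕ) : compDefectSymAt ρs L m (0 : Form1 d ℝ) = 0 :=
  compDefectOf_zero' (avSym_sub ρs L) (lamSym_sub ρs L) m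

/-- [folklore] **THE (0.4) DEFECT POTENTIAL IS ℝ-HOMOGENEOUS.** -/
theorem compDefectSymAt_smul (m : ℕ) (c : ℝ) (A : Form1 d ℝ) :
    compDefectSymAt ρs L m (c • A) = c • compDefectSymAt ρs L m A :=
  compDefectOf_smul (avSym_smul ρs L) (lamSym_smul ρs L) c A m

variable (r : ℕ → (Fin d → ℕ))

/-- [folklore] `Ψˢ_m` is additive. -/
theorem corrPsiSym_add (m : ℕ) (A B : Form1 d ℝ) : corrPsiSym r L m (A + B) = corrPsiSym r L m A + corrPsiSym r L m B :=
  corrPsiOf_add (avSym_sub _ L) (lamSym_sub _ L) m A B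

/-- [folklore] `Ψˢ_m` is ℝ-homogeneous. -/
theorem corrPsiSym_smul (m : ℕ) (c : ℝ) (A : Form1 d ℝ) : corrPsiSym r L m (c • A) = c • corrPsiSym r L m A :=
  corrPsiOf_smul (avSym_smul _ L) (lamSym_smul _ L) m c A

/-- [folklore] `Ψˢ_m 0 = 0`. -/
theorem corrPsiSym_zero (m : ℕ) : corrPsiSym r L m (0 : Form1 d ℝ) = 0 :=
  corrPsiOf_zero (avSym_sub _ L) (lamSym_sub _ L) m

/-- [folklore] `Ψˢ_m` on a finite linear combination. -/
theorem corrPsiSym_sum_smul {ι : Type*} (m : ℕ) (s : Finset ι) (c : ι → ℝ) (B : ι → Form1 d ℝ) :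
    corrPsiSym r L m (∑ i ∈ s, c i • B i) = ∑ i ∈ s, c i • corrPsiSym r L m (B i) :=
  corrPsiOf_sum_smul (avSym_sub _ L) (lamSym_sub _ L) (avSym_smul _ L) (lamSym_smul _ L) m s c B

/-- [folklore] `Φˢ_m` is additive. -/
theorem corrPhiSym_add (m : ℕ) (A B : Form1 d ℝ) : corrPhiSym r L m (A + B) = corrPhiSym r L m A + corrPhiSym r L m B :=
  corrPhiOf_add (avSym_sub _ L) (lamSym_sub _ L) m A B

/-- [folklore] `Φˢ_m` is ℝ-homogeneous. -/
theorem corrPhiSym_smul (m : ℕ) (c : ℝ) (A : Form1 d ℝ) : corrPhiSym r L m (c • A) = c • corrPhiSym r L m A :=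
  corrPhiOf_smul (avSym_smul _ L) (lamSym_smul _ L) m c A

/-- [folklore] `Φˢ_m 0 = 0`. -/
theorem corrPhiSym_zero (m : ℕ) : corrPhiSym r L m (0 : Form1 d ℝ) = 0 :=
  corrPhiOf_zero (avSym_sub _ L) (lamSym_sub _ L) m

/-- [folklore] `Φˢ_m` on a finite linear combination. -/
theorem corrPhiSym_sum_smul {ι : Type*} (m : ℕ) (s : Finset ι) (c : ι → ℝ) (B : ι → Form1 d ℝ) :
    corrPhiSym r L m (∑ i ∈ s, c i • B i) = ∑ i ∈ s, c i • corrPhiSym r L m (B i) :=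
  corrPhiOf_sum_smul (avSym_sub _ L) (lamSym_sub _ L) (avSym_smul _ L) (lamSym_smul _ L) m s c B

end Sym

end

end Summit.QuantumFields.BalabanUV.Beta.CompositeAveragingCoarseExactGeneric
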